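import Summits.QuantumFields.YangMills.Theses.FibreConvexityTail
import Summits.QuantumFields.YangMills.Theses.FirstExitWindow
import Summits.QuantumFields.YangMills.Theorems.FirstExitWindowOneStepWindowBody
import Literature.MathematicalPhysics.QuantumFieldTheory.Balaban1983to89.T3InteriorExcision

/-!
# Route `FibreConvexityTail` — both open tail cruxes `TwoSidedTailL` (stmt-QuantumFields-25567) and `TowerTailL` (stmt-QuantumFields-25568)
# FOLLOW FROM the crux `FirstExitWindowTailL` (stmt-QuantumFields-26243) of route `FirstExitWindow` (lead's cross-route certificate)

The finest-bad-level events of the two routes nest.  Route `FirstExitWindow` bounds the FIRST-EXIT event at level `j`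
`{∀ k < j: Ū^{k} θ_{b₀}(K−k)-small} ∩ {Ū^{j} θ_{b₂}(K−j)-small} ∩ {θ_{b₀}(K−j) ≤ |Ū^{j}(∂p) − 1|}` for EVERY widening `b₂ ≥ b₀`, with constants
uniform in the family and the coupling.  Route `FibreConvexityTail` splits `{∀ k < j small} ∩ {tail}` by the status of the CONDITIONER `Ū^{j+2}`
(small: `TwoSidedTailL`; large somewhere: `TowerTailL`).  Taking for `b₂` the one-step window constant of the landed, route-independent
`FirstExitWindow.oneStepWindow` (crude Prop. 1 of [Balaban1985Averaging]: level `j−1` `θ_{b₀}`-small ⇒ level `j` `θ_{b₂}`-small), BOTH events of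
`FibreConvexityTail` are SUB-EVENTS of the first-exit event (the conditioner constituent is simply dropped), so

  `FirstExitWindowTailL → TwoSidedTailL`   and   `FirstExitWindowTailL → TowerTailL`

by monotonicity of the Gibbs probability, with `(C, A, c) = (max C 0, N, c)` and `γ₁ = min γ₁^{first-exit} γ₁^{window}`.

USE.  A staffing fact for the director/planner, kernel-checked: closing crux 26243 closes the two open cruxes of THIS route (and then, through the
landed glue `HistoryTailOfTwoSided` p609164 and the route's `closes`, the same rung-R3 leaf modulo the shared residual cruxes 19200/20520 — no
leaf-concluding theorem is stated here; compose `FibreConvexityTail.closes` if wanted).  The converse is NOT claimed (the first-exit crux asks for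
constants uniform in `(F, γ)`; the two cruxes here quantify them after `(F, γ)`).

HONEST SCOPE.  Conditional certificates only: no crux, no rung, nothing about the Yang–Mills mass gap is proved (R3 = `YM3TorusSU2` is a RECORD rung,
not the Clay statement).  References: T. Bałaban, CMP 98 (1985) 17–51 [Balaban1985Averaging] Prop. 1 (51) p.26; CMP 102 (1985) 255–275 [Balaban1985UV3]
(7) p.257, (71) p.273.
-/

noncomputable section

open MeasureTheory
open Literature.MathematicalPhysics.QuantumFieldTheory.Balaban1983to89
open Literature.MathematicalPhysics.QuantumFieldTheory.Balaban1983to89.Missing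
open Literature.MathematicalPhysics.QuantumFieldTheory.Balaban1983to89.T4Continuum
open Literature.MathematicalPhysics.QuantumFieldTheory.Balaban1983to89.T3ContinuumYM3Torus
open Literature.MathematicalPhysics.QuantumFieldTheory.Balaban1983to89.T3UnitScaleTilt
open Literature.MathematicalPhysics.QuantumFieldTheory.Balaban1983to89.T3UnitLawDensityEML (ℰp measurableE_ℰp)
open Literature.MathematicalPhysics.QuantumFieldTheory.Balaban1983to89.T3InteriorExcision (θBal_mul)
open Summit.QuantumFields.YangMills.Theorems.FirstExitWindow (oneStepWindow)

namespace Summit.QuantumFields.YangMills.Theorems.FibreConvexityTail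

namespace OfFirstExit

/-- **THE WINDOW STEP ON THE HIERARCHICALLY-SMALL EVENT**: if one (0.4)-averaging maps `θ_{b₀}(K−j)`-small level-`j` fields to `θ_{b₂}(K−(j+1))`-small
level-`(j+1)` fields (the window `FirstExitWindow.oneStepWindow` for one family and coupling) and every level `i < j` of `U` is `θ_{b₀}(K−i)`-small with
`1 ≤ j ≤ K`, then level `j` is `θ_{b₂}(K−j)`-small. [cite: Balaban1985Averaging, Prop. 1 (51) p.26] -/
theorem plaqSmall_of_finer_small {F : T3Family} {γ b₀ b₂ p₀ : ℝ}
    (hW : ∀ (K j : ℕ), j + 1 ≤ K → ∀ U : GaugeField (F.P K) 0 (Matrix.specialUnitaryGroup (Fin 2) ℂ),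
      PlaqSmall (θBal F.L γ b₀ p₀ (K - j)) (Averaging.iter (fun i => BlockAveraging.blockAvg (P := F.P K) (j := i) ℰp) j U) →
      PlaqSmall (θBal F.L γ b₂ p₀ (K - (j + 1)))
        (Averaging.iter (fun i => BlockAveraging.blockAvg (P := F.P K) (j := i) ℰp) (j + 1) U))
    {K j : ℕ} (hj : 1 ≤ j) (hjK : j ≤ K) {U : GaugeField (F.P K) 0 (Matrix.specialUnitaryGroup (Fin 2) ℂ)}
    (hfin : ∀ i, i < j → PlaqSmall (θBal F.L γ b₀ p₀ (K - i))
      (Averaging.iter (fun i' => BlockAveraging.blockAvg (P := F.P K) (j := i') ℰp) i U)) :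
    PlaqSmall (θBal F.L γ b₂ p₀ (K - j)) (Averaging.iter (fun i' => BlockAveraging.blockAvg (P := F.P K) (j := i') ℰp) j U) := by
  obtain ⟨j', rfl⟩ : ∃ j', j = j' + 1 := ⟨j - 1, by omega⟩
  exact hW K j' hjK U (hfin j' (Nat.lt_succ_self j'))

/-- **THE COMMON CORE**: from `FirstExitWindowTailL`, for every `L`, `0 < b₀`, `2 < p₀` a coupling threshold and, for each `(F, γ)`, constants
`C ≥ 0`, `A`, `c > 0` bounding the Gibbs mass of ANY event contained in `{∀ i < j small_{b₀}} ∩ {θ_{b₀}(K−j) ≤ |Ū^{j}(∂a) − 1|}` for `1 ≤ j`,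
`j + 2 ≤ K` — the first-exit bound at the window's widening `b₂`, the window step for the level-`j` smallness, and monotonicity. -/
theorem tail_of_firstExit (h : Summit.QuantumFields.YangMills.Theses.FirstExitWindow.FirstExitWindowTailL) (L : ℕ) {b₀ p₀ : ℝ}
    (hb₀ : 0 < b₀) (hp₀ : 2 < p₀) :
    ∃ γ₁ : ℝ, 0 < γ₁ ∧ γ₁ ≤ 1 ∧ ∀ (F : T3Family) (γ : ℝ), F.L = L → 0 < γ → γ ≤ γ₁ → ∃ (C : ℝ) (A : ℕ) (c : ℝ), 0 ≤ C ∧ 0 < c ∧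
      ∀ (K j : ℕ), 1 ≤ j → j + 2 ≤ K → ∀ (a : Plaq (F.P K) j) (E : Set (GaugeField (F.P K) 0 (Matrix.specialUnitaryGroup (Fin 2) ℂ))),
        E ⊆ {U | θBal F.L γ b₀ p₀ (K - j) ≤ GaugeGroup.dist1 (GaugeField.plaqHol
              (Averaging.iter (fun i' => BlockAveraging.blockAvg (P := F.P K) (j := i') ℰp) j U) a)} ∩
            {U | ∀ i, i < j → PlaqSmall (θBal F.L γ b₀ p₀ (K - i))
              (Averaging.iter (fun i' => BlockAveraging.blockAvg (P := F.P K) (j := i') ℰp) i U)} →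
        (gibbsK F ℰp γ K).real E ≤
          C * (F.scheme ℰp γ).β (K - j) ^ A * Real.exp (-(c * B10.pFun b₀ p₀ (Real.sqrt (γ * ((F.L : ℝ)⁻¹) ^ (K - j))) ^ 2)) := by
  obtain ⟨b₂, γW, hb₂, hγW, hγW1, hW⟩ := oneStepWindow L b₀ p₀ hb₀ hp₀
  obtain ⟨γE, C, c, N, hγE, hγE1, hc, hE⟩ := h L b₀ p₀ b₂ hb₀ hp₀ hb₂
  refine ⟨min γE γW, lt_min hγE hγW, (min_le_left _ _).trans hγE1, fun F γ hFL hγ hle => ?_⟩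
  refine ⟨max C 0, N, c, le_max_right _ _, hc, fun K j hj hjK a E hEsub => ?_⟩
  haveI := isProbabilityMeasure_gibbsK F ℰp hγ.le K
  have hWF := hW F γ hFL hγ (hle.trans (min_le_right _ _))
  have hfirst := hE F γ hFL hγ (hle.trans (min_le_left _ _)) K j hj (by omega) a
  -- the event sits inside the first-exit event at level `j` with widening `b₂`
  have hsub : E ⊆ {U | (∀ k, k < j → PlaqSmall (θBal F.L γ b₀ p₀ (K - k))
        (Averaging.iter (fun i => BlockAveraging.blockAvg (P := F.P K) (j := i) ℰp) k U)) ∧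
      PlaqSmall (θBal F.L γ b₂ p₀ (K - j)) (Averaging.iter (fun i => BlockAveraging.blockAvg (P := F.P K) (j := i) ℰp) j U) ∧
      θBal F.L γ b₀ p₀ (K - j) ≤ GaugeGroup.dist1 (GaugeField.plaqHol
        (Averaging.iter (fun i => BlockAveraging.blockAvg (P := F.P K) (j := i) ℰp) j U) a)} := by
    intro U hU
    have hU' := hEsub hU
    exact ⟨hU'.2, plaqSmall_of_finer_small hWF hj (by omega) hU'.2, hU'.1⟩
  have hβ : (F.scheme ℰp γ).β (K - j) = (γ * ((F.L : ℝ)⁻¹) ^ (K - j))⁻¹ := rfl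
  calc (gibbsK F ℰp γ K).real E
      ≤ (gibbsK F ℰp γ K).real _ := measureReal_mono hsub
    _ ≤ C * ((γ * ((F.L : ℝ)⁻¹) ^ (K - j))⁻¹) ^ N *
          Real.exp (-(c * B10.pFun b₀ p₀ (Real.sqrt (γ * ((F.L : ℝ)⁻¹) ^ (K - j))) ^ 2)) := hfirst
    _ ≤ max C 0 * ((γ * ((F.L : ℝ)⁻¹) ^ (K - j))⁻¹) ^ N *
          Real.exp (-(c * B10.pFun b₀ p₀ (Real.sqrt (γ * ((F.L : ℝ)⁻¹) ^ (K - j))) ^ 2)) := by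
        gcongr
        exact le_max_left _ _
    _ = max C 0 * (F.scheme ℰp γ).β (K - j) ^ N *
          Real.exp (-(c * B10.pFun b₀ p₀ (Real.sqrt (γ * ((F.L : ℝ)⁻¹) ^ (K - j))) ^ 2)) := by rw [hβ]

end OfFirstExit

open OfFirstExit

/-- **`FirstExitWindowTailL → TwoSidedTailL`**: the two-sided event (conditioner small) is a sub-event of the first-exit event at the window's widening;
`bmin = 0` (any profile `b₀ > 0` works), `γ₁ = min γ₁^{first-exit} γ₁^{window}`, `(C, A, c) = (max C 0, N, c)`.  Conditional certificate; the crux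
`TwoSidedTailL` (stmt-QuantumFields-25567) stays open. -/
theorem twoSidedTailL_of_firstExitWindowTailL (h : Summit.QuantumFields.YangMills.Theses.FirstExitWindow.FirstExitWindowTailL) :
    Summit.QuantumFields.YangMills.Theses.FibreConvexityTail.TwoSidedTailL := by
  intro L
  refine ⟨0, fun b₀ p₀ _ hb₀ hp₀ => ?_⟩
  obtain ⟨γ₁, hγ₁, hγ₁1, hF⟩ := tail_of_firstExit h L hb₀ hp₀
  refine ⟨γ₁, hγ₁, hγ₁1, fun F γ hFL hγ hle => ?_⟩
  obtain ⟨C, A, c, hC, hc, hK⟩ := hF F γ hFL hγ hle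
  exact ⟨C, A, c, hC, hc, fun K j hj hjK a => hK K j hj hjK a _ fun U hU => hU.1⟩

/-- **`FirstExitWindowTailL → TowerTailL`**: the tower event (conditioner LARGE somewhere) is likewise a sub-event of the first-exit event — the
conditioner constituent is dropped.  Conditional certificate; the crux `TowerTailL` (stmt-QuantumFields-25568, the route's isolated residual) stays
open and is NOT attacked here. -/
theorem towerTailL_of_firstExitWindowTailL (h : Summit.QuantumFields.YangMills.Theses.FirstExitWindow.FirstExitWindowTailL) :
    Summit.QuantumFields.YangMills.Theses.FibreConvexityTail.TowerTailL := by
  intro L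
  refine ⟨0, fun b₀ p₀ _ hb₀ hp₀ => ?_⟩
  obtain ⟨γ₁, hγ₁, hγ₁1, hF⟩ := tail_of_firstExit h L hb₀ hp₀
  refine ⟨γ₁, hγ₁, hγ₁1, fun F γ hFL hγ hle => ?_⟩
  obtain ⟨C, A, c, hC, hc, hK⟩ := hF F γ hFL hγ hle
  exact ⟨C, A, c, hC, hc, fun K j hj hjK a => hK K j hj hjK a _ fun U hU => hU.1⟩

end Summit.QuantumFields.YangMills.Theorems.FibreConvexityTail

end
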